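import Summits.QuantumFields.YangMills.Theorems.UnitScaleTiltProp7Rows84AtEtaSlotT3
import Literature.MathematicalPhysics.QuantumFieldTheory.Balaban1983to89.B11Eq81ExpansionZpow
import HarnessLib

/-!
# Route `UnitScaleTilt`, crux «MinimiserStabilityRegPr» (stmt-QuantumFields-19200, stub EX `stub_existenceMinimalOrbit`, route (α)) — «HZ-84-ETA-MEMBER»:
# **THE LATTICE (84) ROW AT THE T³ MEMBER, SLOT `Δ^η`, FOR EVERY HERMITIAN DIRECTION** — the `hZ` row of ✓`Prop7Eq128AtMemberOfCrit127` (p677812, (127) ⇒ (128)) and of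
# ✓`Prop7Crit93AtMemberOfRow84` (p669617, (111) ⇒ (93)) as a THEOREM: lit ✓`B11Eq81ExpansionZpow.hasDerivAt_actionZ_chartRay_real` (ym3-torus-px19 ✓p665027; every `d`,
# abstract gauge subspace `P`) instantiated at `𝔸 := M₂(ℂ)`, `U₀ := bgOfCfg F K U₀`, `P := (the route reading ιY is Hermitian)`, `Δπ := Δ̂^η := currentCLM … (DeltaEtaSlot … U₀)`,
# `Δ₁ := currentCLM … (DeltaEtaSlot … U₀ + TJSlotP … U₀)` (print's `Δ − Δ⁽²⁾` of (127)), the (W-X′) letters `H := H̃ᴾ := H1f …DeltaPiSlotP… U₀`, `C := C̃ U₀ := A′ ↦ (−i)•CmapTwS U₀ (κ_f • ιA′)`,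
# `W := W80 ρ tr (bgOfCfg U₀) H̃ᴾ C̃ εC (Jcur (bgOfCfg U₀)) Δ̂^η` — lit's four rows `h74 h79 hΔ hΔ₁` DISCHARGED by ✓`Prop7Rows84AtEtaSlot` (px21 g2 ✓p675218), `hPadd hPsmul hτ` discharged here.

Cell `ym3-torus` (HUMAN RULING D-0037, YM ladder rung R3 — YM₃ on T³, NOT d = 4, NOT Clay; YM gap NOT proved), width seat `ym3-torus-px21` gen 3 (explicit-unit helper; lineage px21 g0∕g2∕g3).
THEOREMS ONLY (0 `def`, 0 `sorry`); `--supports stmt-QuantumFields-19200 --as helper`, count-neutral; NO claim on crux ∕ stub ∕ registry.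

THE PRINT.  [Balaban1985Variational] (84) p. 290 «⟨(δ∕δA′)𝔉(A′), δA′⟩ = ⟨δA′, J⟩ + ⟨δA′, Δ₁A′⟩ + ⟨(δ∕δA′)V(A′), δA′⟩»; p. 297 «we get the functional (74), with the operator Δ instead of
Δ_π … ⟨δA′, J⟩ + ⟨δA′, (Δ − Δ⁽²⁾)A′₁⟩ + ⟨δA′, ((δ∕δA′)V)(A′₁)⟩ = 0, (127) for all δA′ satisfying QδA′ = 0».  At the slot `Δ^η` the (81)-expansion's row (r74) «⟨Y, Δ_πY⟩ = ⟨Y, ΔY⟩» is an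
IDENTITY for every Hermitian `Y` (no Landau condition), so (84) holds along EVERY Hermitian ray — exactly what (127)∕(128) consume.
WHAT IS PROVED (member `F`, `K n`, `h : n ≤ K`, weights `c₀ cB`, `0 ≤ a`; `U₀ ∈ 𝔘_k(ε₀)` with `10⁹L²e ≤ 1`, `10¹²L³ε₀ ≤ 1`; ns `…Theorems.Prop7Row84AtEtaSlotMember`):
* §1 `hermitian_reading_add`, `hermitian_reading_real_smul` (the subspace `P := Hermitian reading` is closed under `+` and real scalars), `trace_mul_comm_clm` (lit's `hτ` at `τ := tr`).
* §2 ★★★ **`hasDerivAt_actionZ_chartRay_real_member_eta`** — for every Hermitian `ιA′` with `‖A′‖ < a_C` and every Hermitian `ιδ′`: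
  `HasDerivAt (t ↦ actionZ Tsh η 3 tr (prodCfg (Ucur (bgOfCfg U₀)) η (curL (flat115 (T47 H̃ᴾ C̃ εC (A′ + tδ′)))))) (⟨δ′,J⟩ + ⟨δ′,(Δ̂^η + T̂_Jᴾ)A′⟩ + ⟨δ′, W80 … A′⟩) 0`, DISPLAYED (named
  suppliers): the fibre letter `ρ` with `hρ : tr (ρ ℓ · X) = ℓ X` (generic, as in lit), the Sect. C regime `RC : Regime H̃ᴾ 0 C̃ b 0 C₂ c₄ 0 a_C εC` and `hC : Prop4Hyp C̃ C₂ c₄` ((W-X′) numerics;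
  ✓`Prop7SectET3WCurrentProp4Rows.prop4Hyp_CmapTwS_conj_zeroJet` class), `hPT` (the chart `T47` keeps Hermitian readings on the ball — `H̃ᴾ`∕`Dfix` reality, ✓`Prop7SectET3RealityPInv`-class + (51)).
* §3 ★★ **`hasDerivAt_actionZ_chartRay_real_member_eta'`** — the same derivative RE-BRACKETED as `⟨δ′,J⟩ + ⟨δ′, Δ̂^η A′⟩ + ⟨δ′, (W80 … + T̂_Jᴾ) A′⟩` (the `T_J`-term folded into the opaque
  `(δ∕δA′)V` letter — the other bookkeeping the EX namer may choose for S11's source `x`), via `pair27_currentCLM_add` (a read current is additive in the operator, at the pairing level).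
HONEST SCOPE.  Instantiation of a landed lit theorem over landed member rows; the regime∕`Prop4Hyp`∕`hPT` rows are DISPLAYED, not discharged; no estimate of [B11] Sect. C is proved here; not a
proof of any stub; nothing continuum ∕ OS ∕ mass-gap ∕ Clay.
-/

set_option autoImplicit false

noncomputable section

open scoped InnerProductSpace ComplexConjugate Matrix.Norms.L2Operator BigOperators Topology
open Complex (I)

namespace Summit.QuantumFields.YangMills.Theorems.Prop7Row84AtEtaSlotMember

open Literature.MathematicalPhysics.QuantumFieldTheory.Balaban1983to89
open Literature.MathematicalPhysics.QuantumFieldTheory.Balaban1983to89.T3ContinuumYM3Torus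
open T3SectALandauChart (eta eta_pos)
open T3PrintedRegularMinimiser (RegPr)
open B9SectCLatticeCarrier (Bond)
open B11Eq115Space (NegSize Space115 JetSup NegSup)
open B11Eq111FrakG (nabla115)
open B11Eq103H1Complex (BondL2K funEquiv)
open B11Eq98CurrentSlot (Jcur)
open B11Eq90Transpose (pair27)
open B11Eq90V0primeCurrent (Tsh Ucur curL flat115 flat115_apply)
open B11Eq90V0GroupComposed (T47)
open B11Eq80Current (W80 quadPart)
open B11Eq174Chart (Regime)
open B11Prop6Scheme (Prop4Hyp)
open B11Eq81ExpansionZpow (hasDerivAt_actionZ_chartRay_real)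
open B9Eq3119DeltaPiCarrier (currentCLM)
open B9Eq39Adjoint (prodCfg)
open B9Eq31ActionZpow (actionZ)
open Summit.QuantumFields.YangMills.Theorems.Prop7SectET3Transport (periodsT3 bondEquiv bgOfCfg)
open Summit.QuantumFields.YangMills.Theorems.Prop7SectET3HilbertLetters (W₂ frobEquiv)
open Summit.QuantumFields.YangMills.Theorems.Prop7SectET3CurvedPropagators (H1f)
open Summit.QuantumFields.YangMills.Theorems.Prop7SectET3DeltaPiPInv (DeltaPiSlotP)
open Summit.QuantumFields.YangMills.Theorems.Prop7SectET3DeltaOnePInv (TJSlotP)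
open Summit.QuantumFields.YangMills.Theorems.Prop7SymAvgTwSym (CmapTwS)
open Summit.QuantumFields.YangMills.Theorems.Prop7SectET3WilsonHessian (DeltaEtaSlot)
open Summit.QuantumFields.YangMills.Theorems.Prop7Rows84AtEtaSlot (h74_member_DeltaEtaSlot h79_member_DeltaEtaTJ hDelta_member_DeltaEtaSlot hDelta1_member_DeltaEtaTJ)
open Summit.QuantumFields.YangMills.Theorems.Prop7Crit93OfEq111 (pair27_eq_inner_toL2 toL2_currentCLM)
open B11Eq90Transpose (pair27_add_left)

variable {F : T3Family} {n K : ℕ} {h : n ≤ K} {c₀ cB a : ℝ} [Fact (0 < c₀)] [Fact (0 < cB)]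
variable [Fact (0 < (F.L : ℝ))] [Fact (0 < ((F.L : ℝ)⁻¹) ^ (K - n))]

/-! ## §1 The Hermitian-reading subspace and the tracial row -/

omit [Fact (0 < c₀)] [Fact (0 < cB)] [Fact (0 < (F.L : ℝ))] [Fact (0 < ((F.L : ℝ)⁻¹) ^ (K - n))] in
/-- `P := (ιY Hermitian)` is closed under addition. [cite: Balaban1985Variational, (82)–(83) p.290] -/
theorem hermitian_reading_add (U₀ : GaugeField (F.P K) 0 (Matrix.specialUnitaryGroup (Fin 2) ℂ)) :
    ∀ Y Z : Space115 (F.L : ℝ) (((F.L : ℝ)⁻¹) ^ (K - n)) (fun _ : Bond 3 (periodsT3 F K) => K - n) (fun _ : Bond 3 (periodsT3 F K) × Fin 3 => K - n)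
        (nabla115 (((F.L : ℝ)⁻¹) ^ (K - n)) (bgOfCfg F K U₀)),
      (∀ b : PBond (F.P K) 0, star (JetSup.equiv _ _ _ Y (bondEquiv F K b)) = JetSup.equiv _ _ _ Y (bondEquiv F K b)) →
      (∀ b : PBond (F.P K) 0, star (JetSup.equiv _ _ _ Z (bondEquiv F K b)) = JetSup.equiv _ _ _ Z (bondEquiv F K b)) →
      ∀ b : PBond (F.P K) 0, star (JetSup.equiv _ _ _ (Y + Z) (bondEquiv F K b)) = JetSup.equiv _ _ _ (Y + Z) (bondEquiv F K b) := by
  intro Y Z hY hZ b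
  show star (JetSup.equiv _ _ _ Y (bondEquiv F K b) + JetSup.equiv _ _ _ Z (bondEquiv F K b))
    = JetSup.equiv _ _ _ Y (bondEquiv F K b) + JetSup.equiv _ _ _ Z (bondEquiv F K b)
  rw [star_add, hY, hZ]

omit [Fact (0 < c₀)] [Fact (0 < cB)] [Fact (0 < (F.L : ℝ))] [Fact (0 < ((F.L : ℝ)⁻¹) ^ (K - n))] in
/-- `P := (ιY Hermitian)` is closed under REAL scalars. [cite: Balaban1985Variational, (82)–(83) p.290] -/
theorem hermitian_reading_real_smul (U₀ : GaugeField (F.P K) 0 (Matrix.specialUnitaryGroup (Fin 2) ℂ)) :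
    ∀ (r : ℝ) (Y : Space115 (F.L : ℝ) (((F.L : ℝ)⁻¹) ^ (K - n)) (fun _ : Bond 3 (periodsT3 F K) => K - n) (fun _ : Bond 3 (periodsT3 F K) × Fin 3 => K - n)
        (nabla115 (((F.L : ℝ)⁻¹) ^ (K - n)) (bgOfCfg F K U₀))),
      (∀ b : PBond (F.P K) 0, star (JetSup.equiv _ _ _ Y (bondEquiv F K b)) = JetSup.equiv _ _ _ Y (bondEquiv F K b)) →
      ∀ b : PBond (F.P K) 0, star (JetSup.equiv _ _ _ (((r : ℂ)) • Y) (bondEquiv F K b)) = JetSup.equiv _ _ _ (((r : ℂ)) • Y) (bondEquiv F K b) := by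
  intro r Y hY b
  show star (((r : ℂ)) • JetSup.equiv _ _ _ Y (bondEquiv F K b)) = ((r : ℂ)) • JetSup.equiv _ _ _ Y (bondEquiv F K b)
  rw [star_smul, Complex.star_def, Complex.conj_ofReal, hY]

/-- lit's `hτ` at `τ := tr`: `tr (a·b) = tr (b·a)`. [folklore] -/
theorem trace_mul_comm_clm : ∀ a b : Matrix (Fin 2) (Fin 2) ℂ,
    (LinearMap.toContinuousLinearMap (Matrix.traceLinearMap (Fin 2) ℂ ℂ) : Matrix (Fin 2) (Fin 2) ℂ →L[ℂ] ℂ) (a * b)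
      = (LinearMap.toContinuousLinearMap (Matrix.traceLinearMap (Fin 2) ℂ ℂ) : Matrix (Fin 2) (Fin 2) ℂ →L[ℂ] ℂ) (b * a) := fun a b => by
  simp only [LinearMap.coe_toContinuousLinearMap', Matrix.traceLinearMap_apply, Matrix.trace_mul_comm a b]

/-! ## §2 ★★★ (84) at the member, slot `Δ^η`, every Hermitian direction -/

/-- ★★★ **THE LATTICE (84) AT THE T³ MEMBER, SLOT `Δ^η`, EVERY HERMITIAN DIRECTION** — lit ✓`hasDerivAt_actionZ_chartRay_real` at `U₀ := bgOfCfg F K U₀`, `P := Hermitian reading`,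
`Δπ := Δ̂^η`, `Δ₁ := Δ̂^η + T̂_Jᴾ`, `H := H̃ᴾ`, `C := C̃`, rows `h74 h79 hΔ hΔ₁` by ✓`Prop7Rows84AtEtaSlot`.  DISPLAYED: `hρ` (fibre letter), `RC`, `hC` (Sect. C regime of `(H̃ᴾ, C̃)`), `hPT` (`T47`
keeps Hermitian readings on the ball), `‖A′‖ < a_C`, Hermitian `ιA′`, Hermitian `ιδ′`.  The conclusion is the `hZ` row of ✓`Prop7Eq128AtMemberOfCrit127.exists_eq_adjoint_Qk_of_hCrit127_of_hasDerivAt_actionZ`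
(at `Δx U₀ := DeltaEtaSlot … U₀ + TJSlotP … U₀`, `Tc := T47 H̃ᴾ C̃ εC`, `W := W80 … Δ̂^η`) and of ✓`Prop7Crit93AtMemberOfRow84.deriv_chartRay_eq_zero_of_eq111_of_hasDerivAt_actionZ_chart`.
[cite: Balaban1985Variational, (84) p.290, (74) p.289, (78)–(81) p.290, (127)–(128) p.297; Balaban1985BackgroundPropagators, (3.10)–(3.12) p.392, (3.127) p.421] -/
theorem hasDerivAt_actionZ_chartRay_real_member_eta (ha : 0 ≤ a) {ε₀ e : ℝ} (hε₀ : 0 < ε₀) (he : 0 < e) (hWe : 10 ^ 9 * (F.L : ℝ) ^ 2 * e ≤ 1) (hWε : 10 ^ 12 * (F.L : ℝ) ^ 3 * ε₀ ≤ 1)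
    (U₀ : GaugeField (F.P K) 0 (Matrix.specialUnitaryGroup (Fin 2) ℂ)) (hreg : RegPr F n K ε₀ U₀)
    -- the fibre letter of `W80` (lit's `ρ`, generic) with its trace-duality row
    {ρ : (Matrix (Fin 2) (Fin 2) ℂ →L[ℂ] ℂ) →L[ℂ] Matrix (Fin 2) (Fin 2) ℂ}
    (hρ : ∀ (ℓ : Matrix (Fin 2) (Fin 2) ℂ →L[ℂ] ℂ) (X : Matrix (Fin 2) (Fin 2) ℂ),
      (LinearMap.toContinuousLinearMap (Matrix.traceLinearMap (Fin 2) ℂ ℂ) : Matrix (Fin 2) (Fin 2) ℂ →L[ℂ] ℂ) (ρ ℓ * X) = ℓ X)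
    -- the Sect. C regime of the (W-X′) letters `(H̃ᴾ, C̃)` and Prop. 4's `C`-slot input (DISPLAYED)
    {b C₂ c₄ aC εC : ℝ}
    (RC : Regime (H1f F n K h c₀ cB a (DeltaPiSlotP F n K h c₀ cB a) U₀) 0
      (fun A' : Space115 (F.L : ℝ) (((F.L : ℝ)⁻¹) ^ (K - n)) (fun _ : Bond 3 (periodsT3 F K) => K - n) (fun _ : Bond 3 (periodsT3 F K) × Fin 3 => K - n)
          (nabla115 (((F.L : ℝ)⁻¹) ^ (K - n)) (bgOfCfg F K U₀)) =>
        (-Complex.I) • CmapTwS F n K h U₀ (((((eta F n K : ℝ) : ℂ)) * Complex.I) • fun b : PBond (F.P K) 0 => JetSup.equiv _ _ _ A' (bondEquiv F K b)))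
      b 0 C₂ c₄ 0 aC εC)
    (hC : Prop4Hyp (fun A' : Space115 (F.L : ℝ) (((F.L : ℝ)⁻¹) ^ (K - n)) (fun _ : Bond 3 (periodsT3 F K) => K - n) (fun _ : Bond 3 (periodsT3 F K) × Fin 3 => K - n)
          (nabla115 (((F.L : ℝ)⁻¹) ^ (K - n)) (bgOfCfg F K U₀)) =>
        (-Complex.I) • CmapTwS F n K h U₀ (((((eta F n K : ℝ) : ℂ)) * Complex.I) • fun b : PBond (F.P K) 0 => JetSup.equiv _ _ _ A' (bondEquiv F K b))) C₂ c₄)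
    -- the chart `T47 H̃ᴾ C̃ εC` keeps Hermitian readings on the ball (DISPLAYED; (45) `RD*H = 0`'s reality shadow: `H̃ᴾ` and `Dfix` map real to real)
    (hPT : ∀ Y : Space115 (F.L : ℝ) (((F.L : ℝ)⁻¹) ^ (K - n)) (fun _ : Bond 3 (periodsT3 F K) => K - n) (fun _ : Bond 3 (periodsT3 F K) × Fin 3 => K - n)
        (nabla115 (((F.L : ℝ)⁻¹) ^ (K - n)) (bgOfCfg F K U₀)), ‖Y‖ < aC →
      (∀ b : PBond (F.P K) 0, star (JetSup.equiv _ _ _ Y (bondEquiv F K b)) = JetSup.equiv _ _ _ Y (bondEquiv F K b)) →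
      ∀ b : PBond (F.P K) 0,
        star (JetSup.equiv _ _ _ (T47 (H1f F n K h c₀ cB a (DeltaPiSlotP F n K h c₀ cB a) U₀)
            (fun A' : Space115 (F.L : ℝ) (((F.L : ℝ)⁻¹) ^ (K - n)) (fun _ : Bond 3 (periodsT3 F K) => K - n) (fun _ : Bond 3 (periodsT3 F K) × Fin 3 => K - n)
                (nabla115 (((F.L : ℝ)⁻¹) ^ (K - n)) (bgOfCfg F K U₀)) =>
              (-Complex.I) • CmapTwS F n K h U₀ (((((eta F n K : ℝ) : ℂ)) * Complex.I) • fun b : PBond (F.P K) 0 => JetSup.equiv _ _ _ A' (bondEquiv F K b))) εC Y)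
            (bondEquiv F K b))
          = JetSup.equiv _ _ _ (T47 (H1f F n K h c₀ cB a (DeltaPiSlotP F n K h c₀ cB a) U₀)
            (fun A' : Space115 (F.L : ℝ) (((F.L : ℝ)⁻¹) ^ (K - n)) (fun _ : Bond 3 (periodsT3 F K) => K - n) (fun _ : Bond 3 (periodsT3 F K) × Fin 3 => K - n)
                (nabla115 (((F.L : ℝ)⁻¹) ^ (K - n)) (bgOfCfg F K U₀)) =>
              (-Complex.I) • CmapTwS F n K h U₀ (((((eta F n K : ℝ) : ℂ)) * Complex.I) • fun b : PBond (F.P K) 0 => JetSup.equiv _ _ _ A' (bondEquiv F K b))) εC Y)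
            (bondEquiv F K b))
    -- the point and the direction: Hermitian readings, the point in the chart ball
    {A' : Space115 (F.L : ℝ) (((F.L : ℝ)⁻¹) ^ (K - n)) (fun _ : Bond 3 (periodsT3 F K) => K - n) (fun _ : Bond 3 (periodsT3 F K) × Fin 3 => K - n)
      (nabla115 (((F.L : ℝ)⁻¹) ^ (K - n)) (bgOfCfg F K U₀))}
    (hA' : ‖A'‖ < aC) (hAR : ∀ b : PBond (F.P K) 0, star (JetSup.equiv _ _ _ A' (bondEquiv F K b)) = JetSup.equiv _ _ _ A' (bondEquiv F K b))
    {δ' : Space115 (F.L : ℝ) (((F.L : ℝ)⁻¹) ^ (K - n)) (fun _ : Bond 3 (periodsT3 F K) => K - n) (fun _ : Bond 3 (periodsT3 F K) × Fin 3 => K - n)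
      (nabla115 (((F.L : ℝ)⁻¹) ^ (K - n)) (bgOfCfg F K U₀))}
    (hδR : ∀ b : PBond (F.P K) 0, star (JetSup.equiv _ _ _ δ' (bondEquiv F K b)) = JetSup.equiv _ _ _ δ' (bondEquiv F K b)) :
    HasDerivAt (fun t : ℝ => actionZ Tsh (((F.L : ℝ)⁻¹) ^ (K - n)) 3
        ((LinearMap.toContinuousLinearMap (Matrix.traceLinearMap (Fin 2) ℂ ℂ) : Matrix (Fin 2) (Fin 2) ℂ →L[ℂ] ℂ) : Matrix (Fin 2) (Fin 2) ℂ →ₗ[ℂ] ℂ)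
        (prodCfg (Ucur (bgOfCfg F K U₀)) (((F.L : ℝ)⁻¹) ^ (K - n)) (curL (flat115
          (T47 (H1f F n K h c₀ cB a (DeltaPiSlotP F n K h c₀ cB a) U₀)
            (fun A' : Space115 (F.L : ℝ) (((F.L : ℝ)⁻¹) ^ (K - n)) (fun _ : Bond 3 (periodsT3 F K) => K - n) (fun _ : Bond 3 (periodsT3 F K) × Fin 3 => K - n)
                (nabla115 (((F.L : ℝ)⁻¹) ^ (K - n)) (bgOfCfg F K U₀)) =>
              (-Complex.I) • CmapTwS F n K h U₀ (((((eta F n K : ℝ) : ℂ)) * Complex.I) • fun b : PBond (F.P K) 0 => JetSup.equiv _ _ _ A' (bondEquiv F K b))) εC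
            (A' + (t : ℂ) • δ'))))))
      (pair27 (LinearMap.toContinuousLinearMap (Matrix.traceLinearMap (Fin 2) ℂ ℂ))
          (Jcur (bgOfCfg F K U₀) : NegSize (F.L : ℝ) (((F.L : ℝ)⁻¹) ^ (K - n)) (fun _ : Bond 3 (periodsT3 F K) => K - n) 3 (Matrix (Fin 2) (Fin 2) ℂ)) (flat115 δ')
        + pair27 (LinearMap.toContinuousLinearMap (Matrix.traceLinearMap (Fin 2) ℂ ℂ))
            (currentCLM frobEquiv (fun _ : Bond 3 (periodsT3 F K) × Fin 3 => K - n) (nabla115 (((F.L : ℝ)⁻¹) ^ (K - n)) (bgOfCfg F K U₀))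
              (DeltaEtaSlot F n K c₀ U₀ + TJSlotP F n K h c₀ cB a U₀) A') (flat115 δ')
        + pair27 (LinearMap.toContinuousLinearMap (Matrix.traceLinearMap (Fin 2) ℂ ℂ))
            (W80 ρ (LinearMap.toContinuousLinearMap (Matrix.traceLinearMap (Fin 2) ℂ ℂ)) (bgOfCfg F K U₀) (H1f F n K h c₀ cB a (DeltaPiSlotP F n K h c₀ cB a) U₀)
              (fun A' : Space115 (F.L : ℝ) (((F.L : ℝ)⁻¹) ^ (K - n)) (fun _ : Bond 3 (periodsT3 F K) => K - n) (fun _ : Bond 3 (periodsT3 F K) × Fin 3 => K - n)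
                  (nabla115 (((F.L : ℝ)⁻¹) ^ (K - n)) (bgOfCfg F K U₀)) =>
                (-Complex.I) • CmapTwS F n K h U₀ (((((eta F n K : ℝ) : ℂ)) * Complex.I) • fun b : PBond (F.P K) 0 => JetSup.equiv _ _ _ A' (bondEquiv F K b))) εC
              (Jcur (bgOfCfg F K U₀))
              (currentCLM frobEquiv (fun _ : Bond 3 (periodsT3 F K) × Fin 3 => K - n) (nabla115 (((F.L : ℝ)⁻¹) ^ (K - n)) (bgOfCfg F K U₀)) (DeltaEtaSlot F n K c₀ U₀)) A')
            (flat115 δ')) 0 :=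
  hasDerivAt_actionZ_chartRay_real hρ trace_mul_comm_clm (bgOfCfg F K U₀) RC hC
    (hDelta_member_DeltaEtaSlot (n := n) (c₀ := c₀) U₀) (hDelta1_member_DeltaEtaTJ ha hε₀ he hWe hWε U₀ hreg)
    (fun Y => ∀ b : PBond (F.P K) 0, star (JetSup.equiv _ _ _ Y (bondEquiv F K b)) = JetSup.equiv _ _ _ Y (bondEquiv F K b))
    (h74_member_DeltaEtaSlot (n := n) (c₀ := c₀) U₀) (h79_member_DeltaEtaTJ ha hε₀ he hWe hWε U₀ hreg)
    hPT (hermitian_reading_add U₀) (hermitian_reading_real_smul U₀) hA' hAR hδR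

/-! ## §3 The same derivative with the `T_J`-term folded into the `(δ∕δA′)V` letter -/

omit [Fact (0 < cB)] in
/-- **A READ CURRENT IS ADDITIVE IN THE OPERATOR, AT THE PAIRING LEVEL**: `⟨δ, (S + T)^ Y⟩ = ⟨δ, Ŝ Y⟩ + ⟨δ, T̂ Y⟩` (✓`pair27_eq_inner_toL2` + ✓`toL2_currentCLM`).
[cite: Balaban1985Variational, (27) p.282, (80) p.290] -/
theorem pair27_currentCLM_add (U₀ : GaugeField (F.P K) 0 (Matrix.specialUnitaryGroup (Fin 2) ℂ)) (S T : BondL2K ℂ 3 (periodsT3 F K) c₀ W₂ →ₗ[ℂ] BondL2K ℂ 3 (periodsT3 F K) c₀ W₂)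
    (Y : Space115 (F.L : ℝ) (((F.L : ℝ)⁻¹) ^ (K - n)) (fun _ : Bond 3 (periodsT3 F K) => K - n) (fun _ : Bond 3 (periodsT3 F K) × Fin 3 => K - n)
      (nabla115 (((F.L : ℝ)⁻¹) ^ (K - n)) (bgOfCfg F K U₀))) (g : Bond 3 (periodsT3 F K) → Matrix (Fin 2) (Fin 2) ℂ) :
    pair27 (LinearMap.toContinuousLinearMap (Matrix.traceLinearMap (Fin 2) ℂ ℂ))
        (currentCLM frobEquiv (fun _ : Bond 3 (periodsT3 F K) × Fin 3 => K - n) (nabla115 (((F.L : ℝ)⁻¹) ^ (K - n)) (bgOfCfg F K U₀)) (S + T) Y) g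
      = pair27 (LinearMap.toContinuousLinearMap (Matrix.traceLinearMap (Fin 2) ℂ ℂ))
          (currentCLM frobEquiv (fun _ : Bond 3 (periodsT3 F K) × Fin 3 => K - n) (nabla115 (((F.L : ℝ)⁻¹) ^ (K - n)) (bgOfCfg F K U₀)) S Y) g
        + pair27 (LinearMap.toContinuousLinearMap (Matrix.traceLinearMap (Fin 2) ℂ ℂ))
          (currentCLM frobEquiv (fun _ : Bond 3 (periodsT3 F K) × Fin 3 => K - n) (nabla115 (((F.L : ℝ)⁻¹) ^ (K - n)) (bgOfCfg F K U₀)) T Y) g := by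
  rw [pair27_eq_inner_toL2 (c₀ := c₀), pair27_eq_inner_toL2 (c₀ := c₀), pair27_eq_inner_toL2 (c₀ := c₀), toL2_currentCLM, toL2_currentCLM, toL2_currentCLM,
    LinearMap.add_apply, inner_add_right]
  ring

/-- ★★ **THE LATTICE (84) AT THE MEMBER, SLOT `Δ^η`, `T_J` FOLDED INTO THE `(δ∕δA′)V` LETTER**: the derivative of §2 re-bracketed as `⟨δ′,J⟩ + ⟨δ′, Δ̂^η A′⟩ + ⟨δ′, (W80 … + T̂_Jᴾ) A′⟩` — the `hZ` row of
✓`Prop7Eq128AtMemberOfCrit127` at `Δx U₀ := DeltaEtaSlot … U₀` (S11's junction slot) with `W := A′ ↦ W80 … A′ + T̂_Jᴾ A′` (the source `x := Ĵ + Ŵ_Δ + T̂_Jᴾ Â′` bookkeeping, print's `G`).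
[cite: Balaban1985Variational, (84) p.290, (127)–(128) p.297; Balaban1985BackgroundPropagators, (3.26) p.395, (3.127) p.421] -/
theorem hasDerivAt_actionZ_chartRay_real_member_eta' (ha : 0 ≤ a) {ε₀ e : ℝ} (hε₀ : 0 < ε₀) (he : 0 < e) (hWe : 10 ^ 9 * (F.L : ℝ) ^ 2 * e ≤ 1) (hWε : 10 ^ 12 * (F.L : ℝ) ^ 3 * ε₀ ≤ 1)
    (U₀ : GaugeField (F.P K) 0 (Matrix.specialUnitaryGroup (Fin 2) ℂ)) (hreg : RegPr F n K ε₀ U₀)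
    {ρ : (Matrix (Fin 2) (Fin 2) ℂ →L[ℂ] ℂ) →L[ℂ] Matrix (Fin 2) (Fin 2) ℂ}
    (hρ : ∀ (ℓ : Matrix (Fin 2) (Fin 2) ℂ →L[ℂ] ℂ) (X : Matrix (Fin 2) (Fin 2) ℂ),
      (LinearMap.toContinuousLinearMap (Matrix.traceLinearMap (Fin 2) ℂ ℂ) : Matrix (Fin 2) (Fin 2) ℂ →L[ℂ] ℂ) (ρ ℓ * X) = ℓ X)
    {b C₂ c₄ aC εC : ℝ}
    (RC : Regime (H1f F n K h c₀ cB a (DeltaPiSlotP F n K h c₀ cB a) U₀) 0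
      (fun A' : Space115 (F.L : ℝ) (((F.L : ℝ)⁻¹) ^ (K - n)) (fun _ : Bond 3 (periodsT3 F K) => K - n) (fun _ : Bond 3 (periodsT3 F K) × Fin 3 => K - n)
          (nabla115 (((F.L : ℝ)⁻¹) ^ (K - n)) (bgOfCfg F K U₀)) =>
        (-Complex.I) • CmapTwS F n K h U₀ (((((eta F n K : ℝ) : ℂ)) * Complex.I) • fun b : PBond (F.P K) 0 => JetSup.equiv _ _ _ A' (bondEquiv F K b)))
      b 0 C₂ c₄ 0 aC εC)
    (hC : Prop4Hyp (fun A' : Space115 (F.L : ℝ) (((F.L : ℝ)⁻¹) ^ (K - n)) (fun _ : Bond 3 (periodsT3 F K) => K - n) (fun _ : Bond 3 (periodsT3 F K) × Fin 3 => K - n)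
          (nabla115 (((F.L : ℝ)⁻¹) ^ (K - n)) (bgOfCfg F K U₀)) =>
        (-Complex.I) • CmapTwS F n K h U₀ (((((eta F n K : ℝ) : ℂ)) * Complex.I) • fun b : PBond (F.P K) 0 => JetSup.equiv _ _ _ A' (bondEquiv F K b))) C₂ c₄)
    (hPT : ∀ Y : Space115 (F.L : ℝ) (((F.L : ℝ)⁻¹) ^ (K - n)) (fun _ : Bond 3 (periodsT3 F K) => K - n) (fun _ : Bond 3 (periodsT3 F K) × Fin 3 => K - n)
        (nabla115 (((F.L : ℝ)⁻¹) ^ (K - n)) (bgOfCfg F K U₀)), ‖Y‖ < aC →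
      (∀ b : PBond (F.P K) 0, star (JetSup.equiv _ _ _ Y (bondEquiv F K b)) = JetSup.equiv _ _ _ Y (bondEquiv F K b)) →
      ∀ b : PBond (F.P K) 0,
        star (JetSup.equiv _ _ _ (T47 (H1f F n K h c₀ cB a (DeltaPiSlotP F n K h c₀ cB a) U₀)
            (fun A' : Space115 (F.L : ℝ) (((F.L : ℝ)⁻¹) ^ (K - n)) (fun _ : Bond 3 (periodsT3 F K) => K - n) (fun _ : Bond 3 (periodsT3 F K) × Fin 3 => K - n)
                (nabla115 (((F.L : ℝ)⁻¹) ^ (K - n)) (bgOfCfg F K U₀)) =>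
              (-Complex.I) • CmapTwS F n K h U₀ (((((eta F n K : ℝ) : ℂ)) * Complex.I) • fun b : PBond (F.P K) 0 => JetSup.equiv _ _ _ A' (bondEquiv F K b))) εC Y)
            (bondEquiv F K b))
          = JetSup.equiv _ _ _ (T47 (H1f F n K h c₀ cB a (DeltaPiSlotP F n K h c₀ cB a) U₀)
            (fun A' : Space115 (F.L : ℝ) (((F.L : ℝ)⁻¹) ^ (K - n)) (fun _ : Bond 3 (periodsT3 F K) => K - n) (fun _ : Bond 3 (periodsT3 F K) × Fin 3 => K - n)
                (nabla115 (((F.L : ℝ)⁻¹) ^ (K - n)) (bgOfCfg F K U₀)) =>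
              (-Complex.I) • CmapTwS F n K h U₀ (((((eta F n K : ℝ) : ℂ)) * Complex.I) • fun b : PBond (F.P K) 0 => JetSup.equiv _ _ _ A' (bondEquiv F K b))) εC Y)
            (bondEquiv F K b))
    {A' : Space115 (F.L : ℝ) (((F.L : ℝ)⁻¹) ^ (K - n)) (fun _ : Bond 3 (periodsT3 F K) => K - n) (fun _ : Bond 3 (periodsT3 F K) × Fin 3 => K - n)
      (nabla115 (((F.L : ℝ)⁻¹) ^ (K - n)) (bgOfCfg F K U₀))}
    (hA' : ‖A'‖ < aC) (hAR : ∀ b : PBond (F.P K) 0, star (JetSup.equiv _ _ _ A' (bondEquiv F K b)) = JetSup.equiv _ _ _ A' (bondEquiv F K b))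
    {δ' : Space115 (F.L : ℝ) (((F.L : ℝ)⁻¹) ^ (K - n)) (fun _ : Bond 3 (periodsT3 F K) => K - n) (fun _ : Bond 3 (periodsT3 F K) × Fin 3 => K - n)
      (nabla115 (((F.L : ℝ)⁻¹) ^ (K - n)) (bgOfCfg F K U₀))}
    (hδR : ∀ b : PBond (F.P K) 0, star (JetSup.equiv _ _ _ δ' (bondEquiv F K b)) = JetSup.equiv _ _ _ δ' (bondEquiv F K b)) :
    HasDerivAt (fun t : ℝ => actionZ Tsh (((F.L : ℝ)⁻¹) ^ (K - n)) 3
        ((LinearMap.toContinuousLinearMap (Matrix.traceLinearMap (Fin 2) ℂ ℂ) : Matrix (Fin 2) (Fin 2) ℂ →L[ℂ] ℂ) : Matrix (Fin 2) (Fin 2) ℂ →ₗ[ℂ] ℂ)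
        (prodCfg (Ucur (bgOfCfg F K U₀)) (((F.L : ℝ)⁻¹) ^ (K - n)) (curL (flat115
          (T47 (H1f F n K h c₀ cB a (DeltaPiSlotP F n K h c₀ cB a) U₀)
            (fun A' : Space115 (F.L : ℝ) (((F.L : ℝ)⁻¹) ^ (K - n)) (fun _ : Bond 3 (periodsT3 F K) => K - n) (fun _ : Bond 3 (periodsT3 F K) × Fin 3 => K - n)
                (nabla115 (((F.L : ℝ)⁻¹) ^ (K - n)) (bgOfCfg F K U₀)) =>
              (-Complex.I) • CmapTwS F n K h U₀ (((((eta F n K : ℝ) : ℂ)) * Complex.I) • fun b : PBond (F.P K) 0 => JetSup.equiv _ _ _ A' (bondEquiv F K b))) εC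
            (A' + (t : ℂ) • δ'))))))
      (pair27 (LinearMap.toContinuousLinearMap (Matrix.traceLinearMap (Fin 2) ℂ ℂ))
          (Jcur (bgOfCfg F K U₀) : NegSize (F.L : ℝ) (((F.L : ℝ)⁻¹) ^ (K - n)) (fun _ : Bond 3 (periodsT3 F K) => K - n) 3 (Matrix (Fin 2) (Fin 2) ℂ)) (flat115 δ')
        + pair27 (LinearMap.toContinuousLinearMap (Matrix.traceLinearMap (Fin 2) ℂ ℂ))
            (currentCLM frobEquiv (fun _ : Bond 3 (periodsT3 F K) × Fin 3 => K - n) (nabla115 (((F.L : ℝ)⁻¹) ^ (K - n)) (bgOfCfg F K U₀))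
              (DeltaEtaSlot F n K c₀ U₀) A') (flat115 δ')
        + pair27 (LinearMap.toContinuousLinearMap (Matrix.traceLinearMap (Fin 2) ℂ ℂ))
            (W80 ρ (LinearMap.toContinuousLinearMap (Matrix.traceLinearMap (Fin 2) ℂ ℂ)) (bgOfCfg F K U₀) (H1f F n K h c₀ cB a (DeltaPiSlotP F n K h c₀ cB a) U₀)
                (fun A' : Space115 (F.L : ℝ) (((F.L : ℝ)⁻¹) ^ (K - n)) (fun _ : Bond 3 (periodsT3 F K) => K - n) (fun _ : Bond 3 (periodsT3 F K) × Fin 3 => K - n)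
                    (nabla115 (((F.L : ℝ)⁻¹) ^ (K - n)) (bgOfCfg F K U₀)) =>
                  (-Complex.I) • CmapTwS F n K h U₀ (((((eta F n K : ℝ) : ℂ)) * Complex.I) • fun b : PBond (F.P K) 0 => JetSup.equiv _ _ _ A' (bondEquiv F K b))) εC
                (Jcur (bgOfCfg F K U₀))
                (currentCLM frobEquiv (fun _ : Bond 3 (periodsT3 F K) × Fin 3 => K - n) (nabla115 (((F.L : ℝ)⁻¹) ^ (K - n)) (bgOfCfg F K U₀)) (DeltaEtaSlot F n K c₀ U₀)) A'
              + currentCLM frobEquiv (fun _ : Bond 3 (periodsT3 F K) × Fin 3 => K - n) (nabla115 (((F.L : ℝ)⁻¹) ^ (K - n)) (bgOfCfg F K U₀))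
                  (TJSlotP F n K h c₀ cB a U₀) A')
            (flat115 δ')) 0 := by
  refine (hasDerivAt_actionZ_chartRay_real_member_eta ha hε₀ he hWe hWε U₀ hreg hρ RC hC hPT hA' hAR hδR).congr_deriv ?_
  rw [pair27_currentCLM_add, pair27_add_left]
  ring

/-! ## §4 (v1.1) The same on the `𝔰𝔲(2)` SECTOR: `P := (Hermitian ∧ traceless reading)` — the sector on which (51) supplies the chart's reality row `hPT` -/

omit [Fact (0 < c₀)] [Fact (0 < cB)] [Fact (0 < (F.L : ℝ))] [Fact (0 < ((F.L : ℝ)⁻¹) ^ (K - n))] in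
/-- `P := (ιY Hermitian ∧ traceless)` is closed under addition. [cite: Balaban1985Variational, (51) p.286, (82)–(83) p.290] -/
theorem su2_reading_add (U₀ : GaugeField (F.P K) 0 (Matrix.specialUnitaryGroup (Fin 2) ℂ)) :
    ∀ Y Z : Space115 (F.L : ℝ) (((F.L : ℝ)⁻¹) ^ (K - n)) (fun _ : Bond 3 (periodsT3 F K) => K - n) (fun _ : Bond 3 (periodsT3 F K) × Fin 3 => K - n)
        (nabla115 (((F.L : ℝ)⁻¹) ^ (K - n)) (bgOfCfg F K U₀)),
      (∀ b : PBond (F.P K) 0, star (JetSup.equiv _ _ _ Y (bondEquiv F K b)) = JetSup.equiv _ _ _ Y (bondEquiv F K b) ∧ Matrix.trace (JetSup.equiv _ _ _ Y (bondEquiv F K b)) = 0) →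
      (∀ b : PBond (F.P K) 0, star (JetSup.equiv _ _ _ Z (bondEquiv F K b)) = JetSup.equiv _ _ _ Z (bondEquiv F K b) ∧ Matrix.trace (JetSup.equiv _ _ _ Z (bondEquiv F K b)) = 0) →
      ∀ b : PBond (F.P K) 0, star (JetSup.equiv _ _ _ (Y + Z) (bondEquiv F K b)) = JetSup.equiv _ _ _ (Y + Z) (bondEquiv F K b) ∧
        Matrix.trace (JetSup.equiv _ _ _ (Y + Z) (bondEquiv F K b)) = 0 := by
  intro Y Z hY hZ b
  show star (JetSup.equiv _ _ _ Y (bondEquiv F K b) + JetSup.equiv _ _ _ Z (bondEquiv F K b))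
      = JetSup.equiv _ _ _ Y (bondEquiv F K b) + JetSup.equiv _ _ _ Z (bondEquiv F K b) ∧
    Matrix.trace (JetSup.equiv _ _ _ Y (bondEquiv F K b) + JetSup.equiv _ _ _ Z (bondEquiv F K b)) = 0
  rw [star_add, (hY b).1, (hZ b).1, Matrix.trace_add, (hY b).2, (hZ b).2, add_zero]
  exact ⟨rfl, rfl⟩

omit [Fact (0 < c₀)] [Fact (0 < cB)] [Fact (0 < (F.L : ℝ))] [Fact (0 < ((F.L : ℝ)⁻¹) ^ (K - n))] in
/-- `P := (ιY Hermitian ∧ traceless)` is closed under REAL scalars. [cite: Balaban1985Variational, (51) p.286, (82)–(83) p.290] -/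
theorem su2_reading_real_smul (U₀ : GaugeField (F.P K) 0 (Matrix.specialUnitaryGroup (Fin 2) ℂ)) :
    ∀ (r : ℝ) (Y : Space115 (F.L : ℝ) (((F.L : ℝ)⁻¹) ^ (K - n)) (fun _ : Bond 3 (periodsT3 F K) => K - n) (fun _ : Bond 3 (periodsT3 F K) × Fin 3 => K - n)
        (nabla115 (((F.L : ℝ)⁻¹) ^ (K - n)) (bgOfCfg F K U₀))),
      (∀ b : PBond (F.P K) 0, star (JetSup.equiv _ _ _ Y (bondEquiv F K b)) = JetSup.equiv _ _ _ Y (bondEquiv F K b) ∧ Matrix.trace (JetSup.equiv _ _ _ Y (bondEquiv F K b)) = 0) →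
      ∀ b : PBond (F.P K) 0, star (JetSup.equiv _ _ _ (((r : ℂ)) • Y) (bondEquiv F K b)) = JetSup.equiv _ _ _ (((r : ℂ)) • Y) (bondEquiv F K b) ∧
        Matrix.trace (JetSup.equiv _ _ _ (((r : ℂ)) • Y) (bondEquiv F K b)) = 0 := by
  intro r Y hY b
  show star (((r : ℂ)) • JetSup.equiv _ _ _ Y (bondEquiv F K b)) = ((r : ℂ)) • JetSup.equiv _ _ _ Y (bondEquiv F K b) ∧
    Matrix.trace (((r : ℂ)) • JetSup.equiv _ _ _ Y (bondEquiv F K b)) = 0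
  rw [star_smul, Complex.star_def, Complex.conj_ofReal, (hY b).1, Matrix.trace_smul, (hY b).2, smul_zero]
  exact ⟨rfl, rfl⟩

/-- ★★★ **(v1.1) THE LATTICE (84) AT THE T³ MEMBER, SLOT `Δ^η`, ON THE `𝔰𝔲(2)` SECTOR** — as `hasDerivAt_actionZ_chartRay_real_member_eta` with lit's subspace `P := (ιY Hermitian ∧ TRACELESS)`:
the directions of `hCrit127` and the chart points of the knit are `𝔰𝔲(2)`-valued, and the chart's reality row `hPT` is asked ON THAT SECTOR ONLY — where (51) ✓`isHermitian_trace_zero_chartTwS`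
(+ (G22)ᴾ ✓`Prop7ChartConjPInv.smul_iota_T47_eq_chart_pinv`) supplies it; ✓p675218's `h74 h79` read the Hermitian half of `P`.  Same conclusion, same displayed `hρ RC hC`, radius.
[cite: Balaban1985Variational, (84) p.290, (51) p.286, (74) p.289, (78)–(81) p.290, (127)–(128) p.297; Balaban1985BackgroundPropagators, (3.10)–(3.12) p.392, (3.127) p.421] -/
theorem hasDerivAt_actionZ_chartRay_real_member_eta_su2 (ha : 0 ≤ a) {ε₀ e : ℝ} (hε₀ : 0 < ε₀) (he : 0 < e) (hWe : 10 ^ 9 * (F.L : ℝ) ^ 2 * e ≤ 1) (hWε : 10 ^ 12 * (F.L : ℝ) ^ 3 * ε₀ ≤ 1)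
    (U₀ : GaugeField (F.P K) 0 (Matrix.specialUnitaryGroup (Fin 2) ℂ)) (hreg : RegPr F n K ε₀ U₀)
    -- the fibre letter of `W80` (lit's `ρ`, generic) with its trace-duality row
    {ρ : (Matrix (Fin 2) (Fin 2) ℂ →L[ℂ] ℂ) →L[ℂ] Matrix (Fin 2) (Fin 2) ℂ}
    (hρ : ∀ (ℓ : Matrix (Fin 2) (Fin 2) ℂ →L[ℂ] ℂ) (X : Matrix (Fin 2) (Fin 2) ℂ),
      (LinearMap.toContinuousLinearMap (Matrix.traceLinearMap (Fin 2) ℂ ℂ) : Matrix (Fin 2) (Fin 2) ℂ →L[ℂ] ℂ) (ρ ℓ * X) = ℓ X)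
    -- the Sect. C regime of the (W-X′) letters `(H̃ᴾ, C̃)` and Prop. 4's `C`-slot input (DISPLAYED)
    {b C₂ c₄ aC εC : ℝ}
    (RC : Regime (H1f F n K h c₀ cB a (DeltaPiSlotP F n K h c₀ cB a) U₀) 0
      (fun A' : Space115 (F.L : ℝ) (((F.L : ℝ)⁻¹) ^ (K - n)) (fun _ : Bond 3 (periodsT3 F K) => K - n) (fun _ : Bond 3 (periodsT3 F K) × Fin 3 => K - n)
          (nabla115 (((F.L : ℝ)⁻¹) ^ (K - n)) (bgOfCfg F K U₀)) =>
        (-Complex.I) • CmapTwS F n K h U₀ (((((eta F n K : ℝ) : ℂ)) * Complex.I) • fun b : PBond (F.P K) 0 => JetSup.equiv _ _ _ A' (bondEquiv F K b)))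
      b 0 C₂ c₄ 0 aC εC)
    (hC : Prop4Hyp (fun A' : Space115 (F.L : ℝ) (((F.L : ℝ)⁻¹) ^ (K - n)) (fun _ : Bond 3 (periodsT3 F K) => K - n) (fun _ : Bond 3 (periodsT3 F K) × Fin 3 => K - n)
          (nabla115 (((F.L : ℝ)⁻¹) ^ (K - n)) (bgOfCfg F K U₀)) =>
        (-Complex.I) • CmapTwS F n K h U₀ (((((eta F n K : ℝ) : ℂ)) * Complex.I) • fun b : PBond (F.P K) 0 => JetSup.equiv _ _ _ A' (bondEquiv F K b))) C₂ c₄)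
    -- the chart `T47 H̃ᴾ C̃ εC` keeps Hermitian readings on the ball (DISPLAYED; (45) `RD*H = 0`'s reality shadow: `H̃ᴾ` and `Dfix` map real to real)
    (hPT : ∀ Y : Space115 (F.L : ℝ) (((F.L : ℝ)⁻¹) ^ (K - n)) (fun _ : Bond 3 (periodsT3 F K) => K - n) (fun _ : Bond 3 (periodsT3 F K) × Fin 3 => K - n)
        (nabla115 (((F.L : ℝ)⁻¹) ^ (K - n)) (bgOfCfg F K U₀)), ‖Y‖ < aC →
      (∀ b : PBond (F.P K) 0, star (JetSup.equiv _ _ _ Y (bondEquiv F K b)) = JetSup.equiv _ _ _ Y (bondEquiv F K b) ∧ Matrix.trace (JetSup.equiv _ _ _ Y (bondEquiv F K b)) = 0) →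
      ∀ b : PBond (F.P K) 0,
        star (JetSup.equiv _ _ _ (T47 (H1f F n K h c₀ cB a (DeltaPiSlotP F n K h c₀ cB a) U₀)
            (fun A' : Space115 (F.L : ℝ) (((F.L : ℝ)⁻¹) ^ (K - n)) (fun _ : Bond 3 (periodsT3 F K) => K - n) (fun _ : Bond 3 (periodsT3 F K) × Fin 3 => K - n)
                (nabla115 (((F.L : ℝ)⁻¹) ^ (K - n)) (bgOfCfg F K U₀)) =>
              (-Complex.I) • CmapTwS F n K h U₀ (((((eta F n K : ℝ) : ℂ)) * Complex.I) • fun b : PBond (F.P K) 0 => JetSup.equiv _ _ _ A' (bondEquiv F K b))) εC Y)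
            (bondEquiv F K b))
          = JetSup.equiv _ _ _ (T47 (H1f F n K h c₀ cB a (DeltaPiSlotP F n K h c₀ cB a) U₀)
            (fun A' : Space115 (F.L : ℝ) (((F.L : ℝ)⁻¹) ^ (K - n)) (fun _ : Bond 3 (periodsT3 F K) => K - n) (fun _ : Bond 3 (periodsT3 F K) × Fin 3 => K - n)
                (nabla115 (((F.L : ℝ)⁻¹) ^ (K - n)) (bgOfCfg F K U₀)) =>
              (-Complex.I) • CmapTwS F n K h U₀ (((((eta F n K : ℝ) : ℂ)) * Complex.I) • fun b : PBond (F.P K) 0 => JetSup.equiv _ _ _ A' (bondEquiv F K b))) εC Y)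
            (bondEquiv F K b) ∧
        Matrix.trace (JetSup.equiv _ _ _ (T47 (H1f F n K h c₀ cB a (DeltaPiSlotP F n K h c₀ cB a) U₀)
            (fun A' : Space115 (F.L : ℝ) (((F.L : ℝ)⁻¹) ^ (K - n)) (fun _ : Bond 3 (periodsT3 F K) => K - n) (fun _ : Bond 3 (periodsT3 F K) × Fin 3 => K - n)
                (nabla115 (((F.L : ℝ)⁻¹) ^ (K - n)) (bgOfCfg F K U₀)) =>
              (-Complex.I) • CmapTwS F n K h U₀ (((((eta F n K : ℝ) : ℂ)) * Complex.I) • fun b : PBond (F.P K) 0 => JetSup.equiv _ _ _ A' (bondEquiv F K b))) εC Y)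
            (bondEquiv F K b)) = 0)
    -- the point and the direction: Hermitian readings, the point in the chart ball
    {A' : Space115 (F.L : ℝ) (((F.L : ℝ)⁻¹) ^ (K - n)) (fun _ : Bond 3 (periodsT3 F K) => K - n) (fun _ : Bond 3 (periodsT3 F K) × Fin 3 => K - n)
      (nabla115 (((F.L : ℝ)⁻¹) ^ (K - n)) (bgOfCfg F K U₀))}
    (hA' : ‖A'‖ < aC) (hAR : ∀ b : PBond (F.P K) 0, star (JetSup.equiv _ _ _ A' (bondEquiv F K b)) = JetSup.equiv _ _ _ A' (bondEquiv F K b) ∧ Matrix.trace (JetSup.equiv _ _ _ A' (bondEquiv F K b)) = 0)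
    {δ' : Space115 (F.L : ℝ) (((F.L : ℝ)⁻¹) ^ (K - n)) (fun _ : Bond 3 (periodsT3 F K) => K - n) (fun _ : Bond 3 (periodsT3 F K) × Fin 3 => K - n)
      (nabla115 (((F.L : ℝ)⁻¹) ^ (K - n)) (bgOfCfg F K U₀))}
    (hδR : ∀ b : PBond (F.P K) 0, star (JetSup.equiv _ _ _ δ' (bondEquiv F K b)) = JetSup.equiv _ _ _ δ' (bondEquiv F K b) ∧ Matrix.trace (JetSup.equiv _ _ _ δ' (bondEquiv F K b)) = 0) :
    HasDerivAt (fun t : ℝ => actionZ Tsh (((F.L : ℝ)⁻¹) ^ (K - n)) 3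
        ((LinearMap.toContinuousLinearMap (Matrix.traceLinearMap (Fin 2) ℂ ℂ) : Matrix (Fin 2) (Fin 2) ℂ →L[ℂ] ℂ) : Matrix (Fin 2) (Fin 2) ℂ →ₗ[ℂ] ℂ)
        (prodCfg (Ucur (bgOfCfg F K U₀)) (((F.L : ℝ)⁻¹) ^ (K - n)) (curL (flat115
          (T47 (H1f F n K h c₀ cB a (DeltaPiSlotP F n K h c₀ cB a) U₀)
            (fun A' : Space115 (F.L : ℝ) (((F.L : ℝ)⁻¹) ^ (K - n)) (fun _ : Bond 3 (periodsT3 F K) => K - n) (fun _ : Bond 3 (periodsT3 F K) × Fin 3 => K - n)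
                (nabla115 (((F.L : ℝ)⁻¹) ^ (K - n)) (bgOfCfg F K U₀)) =>
              (-Complex.I) • CmapTwS F n K h U₀ (((((eta F n K : ℝ) : ℂ)) * Complex.I) • fun b : PBond (F.P K) 0 => JetSup.equiv _ _ _ A' (bondEquiv F K b))) εC
            (A' + (t : ℂ) • δ'))))))
      (pair27 (LinearMap.toContinuousLinearMap (Matrix.traceLinearMap (Fin 2) ℂ ℂ))
          (Jcur (bgOfCfg F K U₀) : NegSize (F.L : ℝ) (((F.L : ℝ)⁻¹) ^ (K - n)) (fun _ : Bond 3 (periodsT3 F K) => K - n) 3 (Matrix (Fin 2) (Fin 2) ℂ)) (flat115 δ')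
        + pair27 (LinearMap.toContinuousLinearMap (Matrix.traceLinearMap (Fin 2) ℂ ℂ))
            (currentCLM frobEquiv (fun _ : Bond 3 (periodsT3 F K) × Fin 3 => K - n) (nabla115 (((F.L : ℝ)⁻¹) ^ (K - n)) (bgOfCfg F K U₀))
              (DeltaEtaSlot F n K c₀ U₀ + TJSlotP F n K h c₀ cB a U₀) A') (flat115 δ')
        + pair27 (LinearMap.toContinuousLinearMap (Matrix.traceLinearMap (Fin 2) ℂ ℂ))
            (W80 ρ (LinearMap.toContinuousLinearMap (Matrix.traceLinearMap (Fin 2) ℂ ℂ)) (bgOfCfg F K U₀) (H1f F n K h c₀ cB a (DeltaPiSlotP F n K h c₀ cB a) U₀)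
              (fun A' : Space115 (F.L : ℝ) (((F.L : ℝ)⁻¹) ^ (K - n)) (fun _ : Bond 3 (periodsT3 F K) => K - n) (fun _ : Bond 3 (periodsT3 F K) × Fin 3 => K - n)
                  (nabla115 (((F.L : ℝ)⁻¹) ^ (K - n)) (bgOfCfg F K U₀)) =>
                (-Complex.I) • CmapTwS F n K h U₀ (((((eta F n K : ℝ) : ℂ)) * Complex.I) • fun b : PBond (F.P K) 0 => JetSup.equiv _ _ _ A' (bondEquiv F K b))) εC
              (Jcur (bgOfCfg F K U₀))
              (currentCLM frobEquiv (fun _ : Bond 3 (periodsT3 F K) × Fin 3 => K - n) (nabla115 (((F.L : ℝ)⁻¹) ^ (K - n)) (bgOfCfg F K U₀)) (DeltaEtaSlot F n K c₀ U₀)) A')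
            (flat115 δ')) 0 :=
  hasDerivAt_actionZ_chartRay_real hρ trace_mul_comm_clm (bgOfCfg F K U₀) RC hC
    (hDelta_member_DeltaEtaSlot (n := n) (c₀ := c₀) U₀) (hDelta1_member_DeltaEtaTJ ha hε₀ he hWe hWε U₀ hreg)
    (fun Y => ∀ b : PBond (F.P K) 0, star (JetSup.equiv _ _ _ Y (bondEquiv F K b)) = JetSup.equiv _ _ _ Y (bondEquiv F K b) ∧ Matrix.trace (JetSup.equiv _ _ _ Y (bondEquiv F K b)) = 0)
    (fun Y hY => h74_member_DeltaEtaSlot (n := n) (c₀ := c₀) U₀ Y fun b => (hY b).1) (fun Y hY => h79_member_DeltaEtaTJ ha hε₀ he hWe hWε U₀ hreg Y fun b => (hY b).1)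
    hPT (su2_reading_add U₀) (su2_reading_real_smul U₀) hA' hAR hδR

end Summit.QuantumFields.YangMills.Theorems.Prop7Row84AtEtaSlotMember

end
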